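import Mathlib
import HarnessLib
import Summits.HubbardSuperconductivity.HubbardSuperconductivity.Theorems.KLProgrammeKLRegimeTwoVolumeLipDoubledDoorData

/-!
# Route `KLProgramme` — crux K3 ENGINE (stmt-HubbardSuperconductivity-20437), stub (e) proof-input «(e)-D-ROWS», keying (A′), REKEY-D file D3b (part 1):
# THE DOUBLED TRANSFER `T⁺ = T ⊕ shift` IN THE BLOCK READING — periodisation and the six row data of the gluing door
# (seat hubbard-kl-k3c4-p1 g27; doubled twins of ✓ `klLipTransfer_periodise` and of the transfer hypotheses of ✓ `…TwoVolumeLipSourceTransfer.lipSourceTransfer_le`)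

* §1 block geometry: `klBlockEquiv_fst_eq_of_site_eq` (the block is read on the site, across sector counts), `klPlainShift_ne_zero_site` / `klBlockEquiv_fst_eq_of_klPlainShift_ne_zero`
  (the plain shift stays at one site, hence in one block), **`klPlainShift_periodise`**, **`klLipTransferD_periodise`** (the `hP` of the gluing door for `T⁺`: copy `0` =
  ✓ `klLipTransfer_periodise`, copy `1` = the plain shift, across copies zero);
* §2 `klBlockEquivD_fst`, `klBlockEquivD_symm_eq`, `sum_filter_fst_srcLabel`, `sum_srcLabel_eq`, `klLipTransferD_apply_00/_11/_01/_10`, and the six block-reading row data of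
  `T⁺ (bL)`: **`hwinD_le`, `hrhoD_le`, `htau1D_le`, `htau2D_le`, `htau3D_le`, `htau4D_le`** — each = the SECTOR datum of `klLipTransfer (bL)` on copy `0` and `≤ 1 ≤ a` / `= 0` on the plain
  copy (one nonzero entry, same site ⇒ same block; at a PLAIN pin the in-block partner must be `Near`: hypothesis `hW`).

Bookkeeping only; nothing asserts the (D) rows, (e), VL, K3 or superconductivity.  References: BGM 2006 §2.7 (2.70)–(2.71), §2.9 (4.3)–(4.6) [cite: BenfattoGiulianiMastropietro2006].
-/

noncomputable section

namespace Summit.HubbardSuperconductivity.HubbardSuperconductivity.Theorems.TwoVolumeLip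

set_option linter.dupNamespace false -- summit = problem name (single-conjunct summit), D-0017

open Finset Literature.MathematicalPhysics.QuantumLattice GrassmannAlgebra Literature.Probability.LatticeModels
open Literature.MathematicalPhysics.QuantumLattice.FermiRG
open Summit.HubbardSuperconductivity.HubbardSuperconductivity.Theorems.KLRegimeSplit
open Summit.HubbardSuperconductivity.HubbardSuperconductivity.Theorems.KLProgrammeLegKernels
open Summit.HubbardSuperconductivity.HubbardSuperconductivity.Theorems.EngineV8
open Summit.HubbardSuperconductivity.HubbardSuperconductivity.Theorems.TwoVolumeSource
open Summit.HubbardSuperconductivity.HubbardSuperconductivity.Theorems.TwoVolumeDefect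

/-! ## D3b §1 Block geometry: the block of a label is read on its site; the plain shift periodises trivially; the doubled transfer periodises -/

section BlockGeom

variable {L b M : ℕ} [NeZero L] [NeZero (b * L)] {N N' : ℕ}

/-- **The block of a fine label depends only on its space-time point** (any two sector-count types). -/
theorem klBlockEquiv_fst_eq_of_site_eq {X : SpaceTimeIdx (b * L) M × SectorLeg N} {X' : SpaceTimeIdx (b * L) M × SectorLeg N'} (h : X.1 = X'.1) :
    (klBlockEquiv L b M N X).1 = (klBlockEquiv L b M N' X').1 := by
  funext i
  apply Fin.ext
  rw [klBlockEquiv_val, klBlockEquiv_val, h]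

/-- The block of an embedded label. -/
theorem klBlockEquiv_fst_symm_apply (blk : Fin 2 → Fin b) (Y : SpaceTimeIdx L M × SectorLeg N) :
    (klBlockEquiv L b M N ((klBlockEquiv L b M N).symm (blk, Y))).1 = blk := by
  rw [Equiv.apply_symm_apply]

/-- **The plain shift links two fine labels at the SAME space-time point**: a nonzero entry forces `Y′.1 = Y.1`. -/
theorem klPlainShift_ne_zero_site {V : ℕ} {Y' : SpaceTimeIdx V M × SectorLeg N'} {Y : SpaceTimeIdx V M × SectorLeg N}
    (h : klPlainShift V M N' N Y' Y ≠ 0) : Y'.1 = Y.1 := by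
  rw [klPlainShift_apply] at h
  by_contra hne
  exact h (if_neg fun hc => hne hc.1)

/-- … hence they lie in the same block. -/
theorem klBlockEquiv_fst_eq_of_klPlainShift_ne_zero {Y' : SpaceTimeIdx (b * L) M × SectorLeg N'} {Y : SpaceTimeIdx (b * L) M × SectorLeg N}
    (h : klPlainShift (b * L) M N' N Y' Y ≠ 0) : (klBlockEquiv L b M N' Y').1 = (klBlockEquiv L b M N Y).1 :=
  klBlockEquiv_fst_eq_of_site_eq (klPlainShift_ne_zero_site h)

/-- **The plain shift PERIODISES trivially**: summed over the fine labels above a coarse label `Y`, the fine plain shift at `X′` is the coarse plain shift at the residue of `X′`: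
`Σ_{res Y″ = Y} klPlainShift (bL) N′ N X′ Y″ = klPlainShift L N′ N (res X′) Y`. -/
theorem klPlainShift_periodise (X' : SpaceTimeIdx (b * L) M × SectorLeg N') (Y : SpaceTimeIdx L M × SectorLeg N) :
    ∑ Y'' ∈ univ.filter (fun Y'' : SpaceTimeIdx (b * L) M × SectorLeg N => klResLabel L b M N Y'' = Y),
        klPlainShift (b * L) M N' N X' Y'' = klPlainShift L M N' N (klResLabel L b M N' X') Y := by
  classical
  -- the only candidate above `Y` at the site of `X′`
  set Y₀ : SpaceTimeIdx (b * L) M × SectorLeg N := (X'.1, Y.2) with hY₀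
  have hres₀ : klResLabel L b M N Y₀ = ((klResLabel L b M N' X').1, Y.2) := by
    rw [klResLabel_eq, klResLabel_eq]
  by_cases hsite : (klResLabel L b M N' X').1 = Y.1
  · -- `Y₀` lies above `Y`; it is the only contributing term
    have hmem : Y₀ ∈ univ.filter (fun Y'' : SpaceTimeIdx (b * L) M × SectorLeg N => klResLabel L b M N Y'' = Y) := by
      rw [Finset.mem_filter]; exact ⟨Finset.mem_univ _, by rw [hres₀, hsite]⟩
    rw [Finset.sum_eq_single_of_mem Y₀ hmem]
    · have hres2 : (klResLabel L b M N' X').2 = X'.2 := by rw [klResLabel_eq]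
      rw [klPlainShift_apply, klPlainShift_apply, hsite, hres2]
      simp only [hY₀, true_and]
    · intro Y'' hY'' hne
      rw [klPlainShift_apply, if_neg]
      rintro ⟨h1, -, -, h4, h5⟩
      apply hne
      rw [Finset.mem_filter] at hY''
      have h2 : Y''.2 = Y.2 := by
        have := congrArg Prod.snd hY''.2
        rw [klResLabel_eq] at this
        exact this
      rw [hY₀]
      exact Prod.ext h1.symm h2
  · -- no fine label at the site of `X′` lies above `Y`
    rw [klPlainShift_apply, if_neg (fun hc => hsite hc.1)]
    refine Finset.sum_eq_zero fun Y'' hY'' => ?_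
    rw [klPlainShift_apply, if_neg]
    rintro ⟨h1, -⟩
    rw [Finset.mem_filter] at hY''
    apply hsite
    have := congrArg Prod.fst hY''.2
    rw [klResLabel_eq] at this
    rw [klResLabel_eq]
    dsimp only at this ⊢
    rw [h1]
    exact this

end BlockGeom

section PeriodiseD

variable {L b M : ℕ} [NeZero L] [NeZero (b * L)] [NeZero M]

/-- **(P_T⁺) THE DOUBLED TRANSFER PERIODISES**: `Σ_{(resD Y′) = Y} klLipTransferD (bL) … X′ Y′ = klLipTransferD L … (resD X′) Y` (copy 0: ✓ `klLipTransfer_periodise`; copy 1: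
`klPlainShift_periodise`; across copies both sides vanish) — the `hP` of the generic gluing door at `e := klBlockEquivD`. -/
theorem klLipTransferD_periodise {β : ℝ} (hβ : β ≠ 0) (μ : ℝ) (K : TrigPolyC4v) (d k : ℕ)
    (X' : SrcLabel (b * L) M (d * k)) (Y : SrcLabel L M (d * k - 1)) :
    ∑ Y' ∈ univ.filter (fun Y' : SrcLabel (b * L) M (d * k - 1) => (klBlockEquivD L b M (d * k - 1) Y').2 = Y),
        klLipTransferD (b * L) M β μ K d k X' Y' = klLipTransferD L M β μ K d k (klBlockEquivD L b M (d * k) X').2 Y := by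
  classical
  obtain ⟨x', s⟩ := X'
  obtain ⟨y, t⟩ := Y
  have h10 : ¬ ((1 : Fin 2) = 0) := by decide
  have h01 : ¬ ((0 : Fin 2) = 1) := by decide
  -- the filter is the product of the residue filter with the singleton copy `t`
  have hfilt : ∀ f : SrcLabel (b * L) M (d * k - 1) → ℂ,
      ∑ Y' ∈ univ.filter (fun Y' : SrcLabel (b * L) M (d * k - 1) => (klBlockEquivD L b M (d * k - 1) Y').2 = (y, t)), f Y' =
        ∑ y' ∈ univ.filter (fun y' : SpaceTimeIdx (b * L) M × SectorLeg (sectorCount (d * k - 1)) => klResLabel L b M (sectorCount (d * k - 1)) y' = y), f (y', t) := by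
    intro f
    rw [Finset.sum_filter, Finset.sum_filter, Fintype.sum_prod_type]
    refine Finset.sum_congr rfl fun y' _ => ?_
    have hkey : ∀ t' : Fin 2, ((klBlockEquivD L b M (d * k - 1) (y', t')).2 = (y, t)) ↔ (klResLabel L b M (sectorCount (d * k - 1)) y' = y ∧ t' = t) := by
      intro t'
      rw [klBlockEquivD_apply, klResLabel]
      constructor
      · intro h; exact ⟨congrArg Prod.fst h, congrArg Prod.snd h⟩
      · rintro ⟨h1, h2⟩; rw [h1, h2]
    simp_rw [hkey]
    by_cases hy : klResLabel L b M (sectorCount (d * k - 1)) y' = y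
    · simp only [hy, true_and, if_true]
      rw [Finset.sum_ite_eq' univ t, if_pos (Finset.mem_univ _)]
    · simp only [hy, false_and, if_false, Finset.sum_const_zero]
  rw [hfilt, klBlockEquivD_apply, klLipTransferD_apply]
  simp only [klLipTransferD_apply]
  rcases Fin.exists_fin_two.1 ⟨s, rfl⟩ with hs | hs <;> rcases Fin.exists_fin_two.1 ⟨t, rfl⟩ with ht | ht <;>
    simp only [hs, ht, h10, h01, and_true, and_false, if_true, if_false, Finset.sum_const_zero]
  · exact klLipTransfer_periodise hβ μ K d k x' y
  · rw [klPlainShift_periodise x' y, klResLabel]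

end PeriodiseD

/-! ## D3b §2 The six block-reading row data of the doubled transfer `T⁺ = T ⊕ shift` (the `hwin hρ hτ₁ hτ₂ hτ₃ hτ₄` of the gluing door) -/

section TransferRowsD

variable {L b M : ℕ} [NeZero L] [NeZero (b * L)] [NeZero M]

omit [NeZero M] in
/-- The block of a doubled label is the block of its position-sector component. -/
theorem klBlockEquivD_fst (n : ℕ) (X : SrcLabel (b * L) M n) : (klBlockEquivD L b M n X).1 = (klBlockEquiv L b M (sectorCount n) X.1).1 := by
  obtain ⟨x, s⟩ := X; rw [klBlockEquivD_apply]

omit [NeZero M] in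
/-- The inverse doubled block structure keeps the copy. -/
theorem klBlockEquivD_symm_eq (n : ℕ) (blk : Fin 2 → Fin b) (Y : SrcLabel L M n) :
    (klBlockEquivD L b M n).symm (blk, Y) = ((klBlockEquiv L b M (sectorCount n)).symm (blk, Y.1), Y.2) := by
  obtain ⟨y, t⟩ := Y; rw [klBlockEquivD_symm_apply]

omit [NeZero L] [NeZero (b * L)] [NeZero M] in
/-- Sums over doubled labels filtered through the first component. -/
theorem sum_filter_fst_srcLabel {V n : ℕ} [NeZero V] (P : SpaceTimeIdx V M × SectorLeg (sectorCount n) → Prop) [DecidablePred P] (f : SrcLabel V M n → ℝ) :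
    ∑ X ∈ univ.filter (fun X : SrcLabel V M n => P X.1), f X = ∑ x ∈ univ.filter P, (f (x, 0) + f (x, 1)) := by
  rw [Finset.sum_filter, Finset.sum_filter, Fintype.sum_prod_type]
  refine Finset.sum_congr rfl fun x _ => ?_
  rw [Fin.sum_univ_two]
  split_ifs <;> simp

omit [NeZero L] [NeZero (b * L)] [NeZero M] in
/-- Unfiltered version. -/
theorem sum_srcLabel_eq {V n : ℕ} [NeZero V] (f : SrcLabel V M n → ℝ) : ∑ X : SrcLabel V M n, f X = ∑ x, (f (x, 0) + f (x, 1)) := by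
  rw [Fintype.sum_prod_type]
  exact Finset.sum_congr rfl fun x _ => Fin.sum_univ_two _

variable {β : ℝ} (μ : ℝ) (K : TrigPolyC4v) (d k : ℕ)

omit [NeZero L] [NeZero M] in
/-- Entries of the doubled transfer at explicit copies. -/
theorem klLipTransferD_apply_00 (x : SpaceTimeIdx (b * L) M × SectorLeg (sectorCount (d * k))) (y : SpaceTimeIdx (b * L) M × SectorLeg (sectorCount (d * k - 1))) :
    klLipTransferD (b * L) M β μ K d k (x, 0) (y, 0) = klLipTransfer (b * L) M β μ K d k x y := by
  rw [klLipTransferD_apply]; simp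

omit [NeZero L] [NeZero M] in
/-- Entries of the doubled transfer at explicit copies. -/
theorem klLipTransferD_apply_11 (x : SpaceTimeIdx (b * L) M × SectorLeg (sectorCount (d * k))) (y : SpaceTimeIdx (b * L) M × SectorLeg (sectorCount (d * k - 1))) :
    klLipTransferD (b * L) M β μ K d k (x, 1) (y, 1) = klPlainShift (b * L) M (sectorCount (d * k)) (sectorCount (d * k - 1)) x y := by
  rw [klLipTransferD_apply]; simp

omit [NeZero L] [NeZero M] in
/-- Entries of the doubled transfer at explicit copies. -/
theorem klLipTransferD_apply_01 (x : SpaceTimeIdx (b * L) M × SectorLeg (sectorCount (d * k))) (y : SpaceTimeIdx (b * L) M × SectorLeg (sectorCount (d * k - 1))) :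
    klLipTransferD (b * L) M β μ K d k (x, 0) (y, 1) = 0 := by
  rw [klLipTransferD_apply]; simp

omit [NeZero L] [NeZero M] in
/-- Entries of the doubled transfer at explicit copies. -/
theorem klLipTransferD_apply_10 (x : SpaceTimeIdx (b * L) M × SectorLeg (sectorCount (d * k))) (y : SpaceTimeIdx (b * L) M × SectorLeg (sectorCount (d * k - 1))) :
    klLipTransferD (b * L) M β μ K d k (x, 1) (y, 0) = 0 := by
  rw [klLipTransferD_apply]; simp

omit [NeZero M] in
/-- **`hwin⁺`**: windowed block sums of `T ⊕ shift` — the sector datum on copy `0`, `≤ 1 ≤ a` on copy `1` (the shift stays in one block). -/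
theorem hwinD_le {a : ℝ} (ha1 : 1 ≤ a)
    (hwin : ∀ (B' : Fin 2 → Fin b) (y : SpaceTimeIdx L M × SectorLeg (sectorCount (d * k - 1))),
      ∑ B : Fin 2 → Fin b, ∑ x ∈ univ.filter (fun x : SpaceTimeIdx (b * L) M × SectorLeg (sectorCount (d * k)) =>
          (klBlockEquiv L b M (sectorCount (d * k)) x).1 = B'),
        ‖klLipTransfer (b * L) M β μ K d k x ((klBlockEquiv L b M (sectorCount (d * k - 1))).symm (B, y))‖ ≤ a)
    (B' : Fin 2 → Fin b) (Y : SrcLabel L M (d * k - 1)) :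
    ∑ B : Fin 2 → Fin b, ∑ X ∈ univ.filter (fun X : SrcLabel (b * L) M (d * k) => (klBlockEquivD L b M (d * k) X).1 = B'),
        ‖klLipTransferD (b * L) M β μ K d k X ((klBlockEquivD L b M (d * k - 1)).symm (B, Y))‖ ≤ a := by
  classical
  obtain ⟨y, t⟩ := Y
  simp_rw [klBlockEquivD_symm_eq, klBlockEquivD_fst]
  simp_rw [sum_filter_fst_srcLabel (fun x : SpaceTimeIdx (b * L) M × SectorLeg (sectorCount (d * k)) => (klBlockEquiv L b M (sectorCount (d * k)) x).1 = B')]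
  rcases Fin.exists_fin_two.1 ⟨t, rfl⟩ with ht | ht
  · simp only [ht, klLipTransferD_apply_00, klLipTransferD_apply_10, norm_zero, add_zero]
    exact hwin B' y
  · simp only [ht, klLipTransferD_apply_01, klLipTransferD_apply_11, norm_zero, zero_add]
    -- only the block `B = B'` contributes, and there the shift column is `≤ 1`
    set yf : (Fin 2 → Fin b) → SpaceTimeIdx (b * L) M × SectorLeg (sectorCount (d * k - 1)) :=
      fun B => (klBlockEquiv L b M (sectorCount (d * k - 1))).symm (B, y) with hyf
    have hvanish : ∀ B, B ≠ B' → ∑ x ∈ univ.filter (fun x : SpaceTimeIdx (b * L) M × SectorLeg (sectorCount (d * k)) =>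
        (klBlockEquiv L b M (sectorCount (d * k)) x).1 = B'), ‖klPlainShift (b * L) M (sectorCount (d * k)) (sectorCount (d * k - 1)) x (yf B)‖ = 0 := by
      intro B hB
      refine Finset.sum_eq_zero fun x hx => ?_
      rw [Finset.mem_filter] at hx
      rw [norm_eq_zero]
      by_contra hne
      have h1 := klBlockEquiv_fst_eq_of_klPlainShift_ne_zero hne
      rw [hx.2, hyf, klBlockEquiv_fst_symm_apply] at h1
      exact hB h1.symm
    rw [Finset.sum_eq_single B' (fun B _ hB => hvanish B hB) (fun h => absurd (Finset.mem_univ _) h)]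
    refine le_trans ?_ ha1
    refine (Finset.sum_le_sum_of_subset_of_nonneg (Finset.filter_subset _ _) fun _ _ _ => norm_nonneg _).trans ?_
    exact colSum_norm_klPlainShift_le_one (sectorCount_pos _) _

omit [NeZero M] in
/-- **`hρ⁺`**: the in-block row of `T ⊕ shift` at the pin — sector datum on copy `0`, `≤ 1 ≤ a` at a plain pin. -/
theorem hrhoD_le {a : ℝ} (ha1 : 1 ≤ a) (W : SrcLabel (b * L) M (d * k))
    (hρ : W.2 = 0 → ∑ y, ‖klLipTransfer (b * L) M β μ K d k W.1
        ((klBlockEquiv L b M (sectorCount (d * k - 1))).symm ((klBlockEquiv L b M (sectorCount (d * k)) W.1).1, y))‖ ≤ a) :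
    ∑ Y, ‖klLipTransferD (b * L) M β μ K d k W ((klBlockEquivD L b M (d * k - 1)).symm ((klBlockEquivD L b M (d * k) W).1, Y))‖ ≤ a := by
  classical
  obtain ⟨w, s⟩ := W
  simp_rw [klBlockEquivD_symm_eq, klBlockEquivD_fst]
  rw [sum_srcLabel_eq]
  rcases Fin.exists_fin_two.1 ⟨s, rfl⟩ with hs | hs
  · simp only [hs, klLipTransferD_apply_00, klLipTransferD_apply_01, norm_zero, add_zero]
    exact hρ hs
  · simp only [hs, klLipTransferD_apply_10, klLipTransferD_apply_11, norm_zero, zero_add]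
    refine le_trans ?_ ha1
    have hinj : Function.Injective (fun y : SpaceTimeIdx L M × SectorLeg (sectorCount (d * k - 1)) =>
        (klBlockEquiv L b M (sectorCount (d * k - 1))).symm ((klBlockEquiv L b M (sectorCount (d * k)) w).1, y)) :=
      fun y y' h => by simpa using (klBlockEquiv L b M (sectorCount (d * k - 1))).symm.injective h
    rw [← Finset.sum_image (f := fun y' => ‖klPlainShift (b * L) M (sectorCount (d * k)) (sectorCount (d * k - 1)) w y'‖) (fun y _ y' _ h => hinj h)]
    exact rowSum_norm_klPlainShift_le_one (sectorCount_pos _) w _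

omit [NeZero M] in
/-- **`hτ₁⁺`**: rows INTO other blocks vanish on the plain copy (the shift stays in one block); copy `0` is the sector datum. -/
theorem htau1D_le {τ : ℝ} (hτ0 : 0 ≤ τ) (W : SrcLabel (b * L) M (d * k))
    (Z : SpaceTimeIdx L M × SectorLeg (sectorCount (d * k - 1)) → Prop)
    (hτ₁ : ∀ y, ¬ Z y → ∑ x ∈ univ.filter (fun x : SpaceTimeIdx (b * L) M × SectorLeg (sectorCount (d * k)) =>
        (klBlockEquiv L b M (sectorCount (d * k)) x).1 ≠ (klBlockEquiv L b M (sectorCount (d * k)) W.1).1),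
      ‖klLipTransfer (b * L) M β μ K d k x ((klBlockEquiv L b M (sectorCount (d * k - 1))).symm ((klBlockEquiv L b M (sectorCount (d * k)) W.1).1, y))‖ ≤ τ)
    (Y : SrcLabel L M (d * k - 1)) (hY : ¬ Z Y.1) :
    ∑ X ∈ univ.filter (fun X : SrcLabel (b * L) M (d * k) => (klBlockEquivD L b M (d * k) X).1 ≠ (klBlockEquivD L b M (d * k) W).1),
        ‖klLipTransferD (b * L) M β μ K d k X ((klBlockEquivD L b M (d * k - 1)).symm ((klBlockEquivD L b M (d * k) W).1, Y))‖ ≤ τ := by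
  classical
  obtain ⟨y, t⟩ := Y
  simp_rw [klBlockEquivD_symm_eq, klBlockEquivD_fst]
  rw [sum_filter_fst_srcLabel (fun x : SpaceTimeIdx (b * L) M × SectorLeg (sectorCount (d * k)) =>
    (klBlockEquiv L b M (sectorCount (d * k)) x).1 ≠ (klBlockEquiv L b M (sectorCount (d * k)) W.1).1)]
  rcases Fin.exists_fin_two.1 ⟨t, rfl⟩ with ht | ht
  · simp only [ht, klLipTransferD_apply_00, klLipTransferD_apply_10, norm_zero, add_zero]
    exact hτ₁ y hY
  · simp only [ht, klLipTransferD_apply_01, klLipTransferD_apply_11, norm_zero, zero_add]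
    refine le_trans (le_of_eq (Finset.sum_eq_zero fun x hx => ?_)) hτ0
    rw [Finset.mem_filter] at hx
    rw [norm_eq_zero]
    by_contra hne
    have h1 := klBlockEquiv_fst_eq_of_klPlainShift_ne_zero hne
    rw [klBlockEquiv_fst_symm_apply] at h1
    exact hx.2 h1

omit [NeZero M] in
/-- **`hτ₂⁺`**: the pin's rows into OTHER blocks — sector datum on copy `0`, zero at a plain pin. -/
theorem htau2D_le {τ : ℝ} (hτ0 : 0 ≤ τ) (W : SrcLabel (b * L) M (d * k))
    (hτ₂ : W.2 = 0 → ∑ B ∈ univ.erase (klBlockEquiv L b M (sectorCount (d * k)) W.1).1, ∑ y,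
      ‖klLipTransfer (b * L) M β μ K d k W.1 ((klBlockEquiv L b M (sectorCount (d * k - 1))).symm (B, y))‖ ≤ τ) :
    ∑ B ∈ univ.erase (klBlockEquivD L b M (d * k) W).1, ∑ Y,
        ‖klLipTransferD (b * L) M β μ K d k W ((klBlockEquivD L b M (d * k - 1)).symm (B, Y))‖ ≤ τ := by
  classical
  obtain ⟨w, s⟩ := W
  simp_rw [klBlockEquivD_symm_eq, klBlockEquivD_fst, sum_srcLabel_eq]
  rcases Fin.exists_fin_two.1 ⟨s, rfl⟩ with hs | hs
  · simp only [hs, klLipTransferD_apply_00, klLipTransferD_apply_01, norm_zero, add_zero]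
    exact hτ₂ hs
  · simp only [hs, klLipTransferD_apply_10, klLipTransferD_apply_11, norm_zero, zero_add]
    refine le_trans (le_of_eq (Finset.sum_eq_zero fun B hB => Finset.sum_eq_zero fun y _ => ?_)) hτ0
    rw [Finset.mem_erase] at hB
    rw [norm_eq_zero]
    by_contra hne
    have h1 := klBlockEquiv_fst_eq_of_klPlainShift_ne_zero hne
    rw [klBlockEquiv_fst_symm_apply] at h1
    exact hB.1 h1.symm

omit [NeZero M] in
/-- **`hτ₃⁺`**: the pin's in-block row over NON-near coarse labels — sector datum on copy `0`; at a plain pin the shift's partner is near (hypothesis `hW`), so the row is zero. -/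
theorem htau3D_le {τ : ℝ} (hτ0 : 0 ≤ τ) (W : SrcLabel (b * L) M (d * k))
    (Near : SpaceTimeIdx L M × SectorLeg (sectorCount (d * k - 1)) → Prop) [DecidablePred Near]
    (hτ₃ : W.2 = 0 → ∑ y ∈ univ.filter (fun y : SpaceTimeIdx L M × SectorLeg (sectorCount (d * k - 1)) => ¬ Near y),
      ‖klLipTransfer (b * L) M β μ K d k W.1
        ((klBlockEquiv L b M (sectorCount (d * k - 1))).symm ((klBlockEquiv L b M (sectorCount (d * k)) W.1).1, y))‖ ≤ τ)
    (hW : W.2 = 1 → ∀ y, klPlainShift (b * L) M (sectorCount (d * k)) (sectorCount (d * k - 1)) W.1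
        ((klBlockEquiv L b M (sectorCount (d * k - 1))).symm ((klBlockEquiv L b M (sectorCount (d * k)) W.1).1, y)) ≠ 0 → Near y) :
    ∑ Y ∈ univ.filter (fun Y : SrcLabel L M (d * k - 1) => ¬ Near Y.1),
        ‖klLipTransferD (b * L) M β μ K d k W ((klBlockEquivD L b M (d * k - 1)).symm ((klBlockEquivD L b M (d * k) W).1, Y))‖ ≤ τ := by
  classical
  obtain ⟨w, s⟩ := W
  simp_rw [klBlockEquivD_symm_eq, klBlockEquivD_fst]
  rw [sum_filter_fst_srcLabel (fun y : SpaceTimeIdx L M × SectorLeg (sectorCount (d * k - 1)) => ¬ Near y)]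
  rcases Fin.exists_fin_two.1 ⟨s, rfl⟩ with hs | hs
  · simp only [hs, klLipTransferD_apply_00, klLipTransferD_apply_01, norm_zero, add_zero]
    exact hτ₃ hs
  · simp only [hs, klLipTransferD_apply_10, klLipTransferD_apply_11, norm_zero, zero_add]
    refine le_trans (le_of_eq (Finset.sum_eq_zero fun y hy => ?_)) hτ0
    rw [Finset.mem_filter] at hy
    rw [norm_eq_zero]
    by_contra hne
    exact hy.2 (hW hs y hne)

omit [NeZero M] in
/-- **`hτ₄⁺`**: in-block rows into labels of OTHER blocks vanish on the plain copy; copy `0` is the sector datum. -/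
theorem htau4D_le {τ : ℝ} (hτ0 : 0 ≤ τ) (W : SrcLabel (b * L) M (d * k))
    (Z : SpaceTimeIdx L M × SectorLeg (sectorCount (d * k - 1)) → Prop)
    (hτ₄ : ∀ y, ¬ Z y → ∑ B ∈ univ.erase (klBlockEquiv L b M (sectorCount (d * k)) W.1).1,
      ∑ x ∈ univ.filter (fun x : SpaceTimeIdx (b * L) M × SectorLeg (sectorCount (d * k)) =>
          (klBlockEquiv L b M (sectorCount (d * k)) x).1 = (klBlockEquiv L b M (sectorCount (d * k)) W.1).1),
        ‖klLipTransfer (b * L) M β μ K d k x ((klBlockEquiv L b M (sectorCount (d * k - 1))).symm (B, y))‖ ≤ τ)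
    (Y : SrcLabel L M (d * k - 1)) (hY : ¬ Z Y.1) :
    ∑ B ∈ univ.erase (klBlockEquivD L b M (d * k) W).1,
      ∑ X ∈ univ.filter (fun X : SrcLabel (b * L) M (d * k) => (klBlockEquivD L b M (d * k) X).1 = (klBlockEquivD L b M (d * k) W).1),
        ‖klLipTransferD (b * L) M β μ K d k X ((klBlockEquivD L b M (d * k - 1)).symm (B, Y))‖ ≤ τ := by
  classical
  obtain ⟨y, t⟩ := Y
  simp_rw [klBlockEquivD_symm_eq, klBlockEquivD_fst]
  simp_rw [sum_filter_fst_srcLabel (fun x : SpaceTimeIdx (b * L) M × SectorLeg (sectorCount (d * k)) =>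
    (klBlockEquiv L b M (sectorCount (d * k)) x).1 = (klBlockEquiv L b M (sectorCount (d * k)) W.1).1)]
  rcases Fin.exists_fin_two.1 ⟨t, rfl⟩ with ht | ht
  · simp only [ht, klLipTransferD_apply_00, klLipTransferD_apply_10, norm_zero, add_zero]
    exact hτ₄ y hY
  · simp only [ht, klLipTransferD_apply_01, klLipTransferD_apply_11, norm_zero, zero_add]
    refine le_trans (le_of_eq (Finset.sum_eq_zero fun B hB => Finset.sum_eq_zero fun x hx => ?_)) hτ0
    rw [Finset.mem_erase] at hB
    rw [Finset.mem_filter] at hx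
    rw [norm_eq_zero]
    by_contra hne
    have h1 := klBlockEquiv_fst_eq_of_klPlainShift_ne_zero hne
    rw [klBlockEquiv_fst_symm_apply, hx.2] at h1
    exact hB.1 h1.symm

end TransferRowsD

end Summit.HubbardSuperconductivity.HubbardSuperconductivity.Theorems.TwoVolumeLip

end
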